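import Literature.Analysis.FluidPDE.NavierStokesConcentration
import Literature.Analysis.FluidPDE.NavierStokesConcentrationCorrectorProofs
import HarnessLib

/-!
# Cheskidov–Luo 2022, Prop. 3.1 (concentrating the stress error), discharged

A. Cheskidov, X. Luo, *Sharp nonuniqueness for the Navier–Stokes equations*, Invent. Math. 229
(2022) 987–1054 = arXiv:2009.06596. Proof file for the named facts of
`Literature.Analysis.FluidPDE.NavierStokesReynoldsSteps` (the two steps of the main iteration,
Prop. 2.2): this file DISCHARGES the first step,

* `Torus.CheskidovLuo2022Concentration_holds : CheskidovLuo2022Concentration` — Prop. 3.1,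

by composing the two halves of its proof already in the tree:

* the gluing-and-bookkeeping half (§§3.2–3.3: sharp cut-offs `χᵢ`, the concentrated stress (3.6),
  Prop. 3.3, the set `I` of §3.3), `Torus.CheskidovLuo2022Concentration_of_corrector`
  (file `NavierStokesConcentration`, with `NavierStokesConcentrationTools`/`…Glue`), and
* the analytic half (§3.1, system (3.2), Prop. 3.2: local smooth solvability of the linearised
  stress-forced Navier–Stokes system on fine grids by Fourier–Picard iteration, and the `L^r`
  antidivergence bound by the heat flow), `Torus.CheskidovLuo2022Corrector_holds`
  (file `NavierStokesConcentrationCorrectorProofs`, with `CorrectorFourier*`,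
  `NavierStokesCorrectorAntidivergence*`, `TorusHeat*`).

As a corollary the main iteration Prop. 2.2 (`Torus.CheskidovLuo2022MainIteration`, file
`NavierStokesReynolds`) now depends on the convex-integration step Prop. 4.1 alone:
`Torus.CheskidovLuo2022MainIteration_of_convexIntegration` (from the proved assembly
`Torus.CheskidovLuo2022MainIteration_of_steps`, §4: "It is clear that Proposition 2.2 follows
from Proposition 3.1 and Proposition 4.1").

The discharge cannot be appended to `NavierStokesReynoldsSteps` itself: the proof files import it
(`NavierStokesConcentrationTools` → `NavierStokesReynoldsSteps`).

## References

* A. Cheskidov, X. Luo, *Sharp nonuniqueness for the Navier–Stokes equations*, Invent. Math. 229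
  (2022), 987–1054; arXiv:2009.06596: Prop. 2.2, Prop. 3.1, §§3.1–3.3, Prop. 3.2, Prop. 4.1 and
  the sentence following it. [`CheskidovLuo2022`]
-/

noncomputable section

namespace Literature.Analysis.FluidPDE

namespace Torus

variable {d : Type*} [Fintype d] [DecidableEq d]

/-- **Cheskidov–Luo 2022, Prop. 3.1 (concentrating the stress error), PROVED** for the rendering
`Torus.CheskidovLuo2022Concentration`: "Let `0 < ε < 1` and `(u, R)` be a well-prepared smooth
solution of (2.1) for some set `Ĩ` and a length scale `τ̃ > 0`. For any `1 < r < ∞`, there exists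
a universal constant `C = C(r, ε) > 0` such that the following holds. For any `δ > 0`, there
exists another well-prepared smooth solution `(ū, R̄)` of (2.1) for some set `I ⊂ Ĩ` with
`0, 1 ∉ I` and `τ < τ̃/2` satisfying … `R̄(t, x) = 0` if `dist(t, Iᶜ) ≤ 3τ/2`,
`‖R̄‖_{L¹(0,1;Lʳ)} ≤ C ‖R‖_{L¹(0,1;Lʳ)}`, `Supp w̄ ⊂ Ĩ × 𝕋^d`, `‖w̄‖_{L^∞(0,1;H^d)} ≤ δ`."
Proof: the gluing argument of §§3.2–3.3 (`CheskidovLuo2022Concentration_of_corrector`) applied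
to the local correctors of §3.1/Prop. 3.2 (`CheskidovLuo2022Corrector_holds`).
[cite: CheskidovLuo2022, Prop. 3.1] -/
theorem CheskidovLuo2022Concentration_holds : CheskidovLuo2022Concentration (d := d) :=
  CheskidovLuo2022Concentration_of_corrector CheskidovLuo2022Corrector_holds

/-- **Cheskidov–Luo 2022, Prop. 2.2 from Prop. 4.1 alone.** With Prop. 3.1 proved
(`CheskidovLuo2022Concentration_holds`), the proved assembly
`CheskidovLuo2022MainIteration_of_steps` (§4, after Prop. 4.1: "It is clear that Proposition 2.2
follows from Proposition 3.1 and Proposition 4.1") reduces the main iteration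
`Torus.CheskidovLuo2022MainIteration` to the convex-integration step
`Torus.CheskidovLuo2022ConvexIntegration`. [cite: CheskidovLuo2022, Prop. 2.2 and §4 (sentence after Prop. 4.1)] -/
theorem CheskidovLuo2022MainIteration_of_convexIntegration
    (h : CheskidovLuo2022ConvexIntegration (d := d)) : CheskidovLuo2022MainIteration (d := d) :=
  CheskidovLuo2022MainIteration_of_steps CheskidovLuo2022Concentration_holds h

end Torus

end Literature.Analysis.FluidPDE

end
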